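import Summits.BirchSwinnertonDyer.BirchSwinnertonDyer.Theorems.GoldfeldAllTwistsTwoConverseTwinQuarterTraceGenus
import HarnessLib

set_option linter.dupNamespace false -- namespace `…BirchSwinnertonDyer.BirchSwinnertonDyer…` is the cell's (D-0017 nested layout)
set_option autoImplicit false

/-!
# LINE C3⁺ (PHASE 2), file P2e-3: the HALF-TRACE CONJUGATION LAW `Φ + τΦ = #Cl(F)² · T` over the PARTNER field `F = ℚ(√−qp)`
# (the genus step of the odd discriminant `−qp = (−q)·p`), and the identity `2Φ = y_F + P′`

Cell `bsd-goldfeld`, seat `bsd-goldfeld-s1p-c3x` (gen 7); planner ORDER (ccxxix)/(ccxxxi) «LINE C3⁺», tranche 2, file P2e (the `χ_e`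
partner), third part: the one NEW construction of PHASE 2 (memo `RK2-MIXED-FAMILY.md` §5′ P2e) — Gross's reflection law summed over the
principal genus of the ODD discriminant `d_F = −qp`, `[C : C²] = 2`. `--supports stmt-BirchSwinnertonDyer-20044` as a HELPER. Theses-free;
theorems only; no definition, no `sorry`, NO new fact: the two named inputs are A″'s `hw` (`w(49a1) = +1`) and `h0` (`φ₀(0) = T`); everything
else is proved in the tree and cited (ty's Shimura reciprocity `exists_shimuraReciprocity_ringClassField_one` and FILE D
`conjPoint_sum_φ_heegnerTau_sqCoset`, A″'s `algEquiv_apply_sqrt_eq_iff_symm_mem_range_sq` and `card_filter_sqCoset_eq_natCard_range`,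
P2f's `index_range_sq_classGroup_QO_eq_two_negTwoPrimes`).

THE STATEMENT (`halfTrace_add_map_conj_eq_negTwoPrimes`). `F` imaginary quadratic, `d_F = −qp` (`q ≡ 3`, `p ≡ 1 (mod 4)` primes,
`(q/7) = −1`, `(p/7) = +1`, so `7` splits in `F`); `L_F = F[1]`; `r ∈ L_F` with `r² = p` (the genus field `F(r) = ℚ(√−q, √p)`); `y = y(1)` the
conductor-one Heegner point of a Kolyvagin–Heegner datum over `L_F`; `τ` complex conjugation; `Φ := Σ_{σ ∈ Gal(L_F/F), σ r = r} σ y` (the sum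
over `Θ(Cl²)`). Then **`Φ + τΦ = #Cl(F)² • T`**, `T = (2, −1)` — with `#Cl(F)² = h(−qp)/2` ODD exactly when `Cl(F)` has no element of order
`4` (Rédei; `(p/q) = −1`), in which case `Φ + τΦ = T`: the hypothesis `hRe : cR_e + R_e = ε_e T`, `ε_e = 1`, of the quarter-trace core (P2a).
Also `two_zsmul_halfSum_eq`: `2Φ = (Σ_σ σ y) + P′`, `P′ = Σ_σ χ′(σ) σ y` the genus point of `(−q, p)`. PROOF = P2b-2's
`quarterTrace_add_map_conj_eq_negEightTwoPrimes` with ONE square root (index `2`) instead of two (index `4`).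
HONEST FRAMING: a Galois-descent identity for Heegner points; no `L`-value; no case of K12₂″ / twin″ decided; BSD is not proved by any of this.

References: [GrossLMS1991] Prop. 5.3; [Darmon2004] Thm. 3.7, Prop. 3.11; [Cox2013] §3.B Thm. 3.15, §6.A Thm. 6.1; [Gross1984] §§4–5. -/

noncomputable section

open scoped Classical

open WeierstrassCurve Literature.NumberTheory.EllipticCurves Literature.NumberTheory.EllipticCurves.ModularForms
  Literature.Computability.Cryptography.Hallgren2005

namespace Summit.BirchSwinnertonDyer.BirchSwinnertonDyer.Theorems.GoldfeldGoodTwists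

/-! ## §1 The sum identity `2Φ = y + P′` and the non-square `p` -/

section Identity

variable {ι A : Type*} [Fintype ι] [AddCommGroup A]

/-- `2·[s] = 1 + χ` summed: `2 • Σ_{s σ} f σ = Σ_σ f σ + Σ_σ χ(σ) f σ`, `χ(σ) = ±1` as `s σ` holds or not. [folklore] -/
theorem two_zsmul_halfSum_eq (s : ι → Prop) (f : ι → A) :
    (2 : ℤ) • ∑ σ, (if s σ then (1 : ℤ) else 0) • f σ = ∑ σ, f σ + ∑ σ, (if s σ then (1 : ℤ) else -1) • f σ := by
  rw [Finset.smul_sum, ← Finset.sum_add_distrib]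
  refine Finset.sum_congr rfl fun σ _ ↦ ?_
  by_cases h : s σ
  · rw [if_pos h, if_pos h, one_zsmul, two_zsmul]
  · rw [if_neg h, if_neg h, zero_zsmul, smul_zero, neg_one_zsmul, add_neg_cancel]

end Identity

section NonSquare

variable {F : Type} [Field F] [NumberField F]

/-- `p` is not a square in `F` when `d_F = −qp` (`p`, `q` primes): else `p` or `p·d_F = −qp² < 0` would be a rational square. [folklore] -/
theorem not_isSquare_natCast_of_discr_negTwoPrimes (hF : IsImaginaryQuadratic F) {q p : ℕ} (hq : q.Prime) (hp : p.Prime)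
    (hdF : NumberField.discr F = -((q : ℤ) * p)) : ¬ IsSquare (p : F) := by
  intro h
  have h' : IsSquare (algebraMap ℚ F (p : ℚ)) := by rwa [map_natCast]
  have hdQ : ((NumberField.discr F : ℤ) : ℚ) = -((q : ℚ) * p) := by rw [hdF]; push_cast; ring
  have hq0 : (0 : ℚ) < q := by exact_mod_cast hq.pos
  have hp0 : (0 : ℚ) < p := by exact_mod_cast hp.pos
  rcases isSquare_or_of_isSquare_algebraMap_rat hF h' with h1 | h1
  · exact not_isSquare_prime hp (Rat.isSquare_natCast_iff.mp h1)
  · rw [hdQ] at h1; exact not_isSquare_of_neg (by nlinarith [mul_pos hq0 hp0]) h1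

end NonSquare

/-! ## §2 The half-trace conjugation law over `F = ℚ(√−qp)` -/

section HalfTrace

variable {F : Type} [Field F] [NumberField F]
variable (ι : F →+* ℂ) [FiniteDimensional F (ringClassField F ι 1)] [IsGalois F (ringClassField F ι 1)]

/-- **THE HALF-TRACE CONJUGATION LAW OVER `ℚ(√−qp)`: `Φ + τΦ = #Cl(F)² • T`** in `X₀(49)(F[1])`, `d_F = −qp` (`q ≡ 3`, `p ≡ 1 (mod 4)`
primes, `(q/7) = −1`, `(p/7) = +1`), `r = √p ∈ F[1]`, `Φ = Σ_{σ r = r} σ·y(1)` the half trace of the conductor-one Heegner point (sum over the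
principal genus `Θ(Cl²)`, index `2`), `τ` complex conjugation, `T = (2, −1)`; stated for any `DecidableEq F[1]`. Inputs BY NAME: `hw` (`w = +1`),
`h0` (`φ(0) = T`). [cite: GrossLMS1991, Prop. 5.3] [cite: Darmon2004, Thm. 3.7 and Prop. 3.11] [cite: Cox2013, §3.B Thm. 3.15] -/
theorem halfTrace_add_map_conj_eq_negTwoPrimes (hF : IsImaginaryQuadratic F) {q p : ℕ} (hq : q.Prime) (hp : p.Prime)
    (hq4 : q % 4 = 3) (hp4 : p % 4 = 1) (hqp : q ≠ p) (hq7 : jacobiSym q 7 = -1) (hp7 : jacobiSym p 7 = 1)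
    (hdF : NumberField.discr F = -((q : ℤ) * p)) {N : ℕ} [NeZero N] (hN : cm7.conductorNorm ℤ = N)
    (D₀ : ModularParametrizationData cm7 N) (hw : cm7.rootNumber = 1) (h0 : ∃ h, D₀.cuspZeroPoint = Affine.Point.some 2 (-1) h)
    {β : ℤ} (d : KolyvaginHeegnerData D₀ β ι 1) {r : ringClassField F ι 1} (hr : (r : ℂ) ^ 2 = (p : ℂ))
    (τ : ringClassField F ι 1 ≃ₐ[ℚ] ringClassField F ι 1)
    (hτ : ∀ x : ringClassField F ι 1, ((τ x : ringClassField F ι 1) : ℂ) = starRingEnd ℂ x)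
    [hdec : DecidableEq (ringClassField F ι 1)] :
    (∑ σ : ringClassField F ι 1 ≃ₐ[F] ringClassField F ι 1,
        (if σ r = r then (1 : ℤ) else 0) • Affine.Point.map (σ : ringClassField F ι 1 →ₐ[F] ringClassField F ι 1) d.y) +
      Affine.Point.map (τ : ringClassField F ι 1 →ₐ[ℚ] ringClassField F ι 1)
        (∑ σ : ringClassField F ι 1 ≃ₐ[F] ringClassField F ι 1,
          (if σ r = r then (1 : ℤ) else 0) • Affine.Point.map (σ : ringClassField F ι 1 →ₐ[F] ringClassField F ι 1) d.y) =
      (Nat.card (powMonoidHom 2 : ClassGroup (OrderCl.QO hF.negDiscr) →* ClassGroup (OrderCl.QO hF.negDiscr)).range) •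
        Affine.Point.some 2 (-1) (nonsingular_cm7_baseChange_two_neg_one (ringClassField F ι 1)) := by
  have hworld : hdec = fun a b ↦ Subtype.instDecidableEq a b := Subsingleton.elim _ _
  subst hworld
  subst hN
  have hp2 : p ≠ 2 := by rintro rfl; norm_num at hp4
  have hq2 : q ≠ 2 := by rintro rfl; norm_num at hq4
  ------------------------------------------------------------------ data: Heegner hypothesis, datum, lift family, Θ, q₁
  have hH : SatisfiesHeegnerHypothesis (cm7.conductorNorm ℤ) F := by
    rw [conductorNorm_cm7, satisfiesHeegnerHypothesis_iff_kronecker 49 F hF.1]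
    intro p' hp' hp49
    have hp7e : p' = 7 := by
      have h : p' ∣ 7 ^ 2 := by simpa using hp49
      exact (Nat.prime_dvd_prime_iff_eq hp' (by norm_num)).mp (hp'.dvd_of_dvd_pow h)
    subst hp7e
    refine ⟨fun h ↦ by omega, fun _ ↦ ?_⟩
    rw [hdF, show (-((q : ℤ) * p)) = -1 * ((q : ℤ) * p) by ring, jacobiSym.mul_left, jacobiSym.mul_left,
      jacobiSym.at_neg_one (by norm_num), ZMod.χ₄_nat_three_mod_four (by norm_num)]
    have hq7z : jacobiSym (q : ℤ) 7 = -1 := hq7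
    have hpjz : jacobiSym (p : ℤ) 7 = 1 := hp7
    rw [hq7z, hpjz]
    norm_num
  have hND : ∀ p' : ℕ, p'.Prime → p' ∣ cm7.conductorNorm ℤ → ¬ (p' : ℤ) ∣ NumberField.discr F :=
    fun p' hp' hpN ↦ not_dvd_discr_of_satisfiesHeegnerHypothesis hF hH hp' hpN
  obtain ⟨H, hHβ⟩ := nonempty_heegnerDatum_holds (cm7.conductorNorm ℤ) F hF d.dvd_sq_sub
  obtain ⟨P, Θ, hPφ, hΘ⟩ := exists_shimuraReciprocity_ringClassField_one hF hH D₀ H ι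
  obtain ⟨q₁, hy⟩ := exists_rep_y_eq_of_kolyvaginHeegnerData hF d H hHβ hPφ
  choose qσ hqσ using fun σ : ringClassField F ι 1 ≃ₐ[F] ringClassField F ι 1 ↦ hΘ (Θ.symm σ) q₁
  have hqσ_map : ∀ σ : ringClassField F ι 1 ≃ₐ[F] ringClassField F ι 1,
      Affine.Point.map (σ : ringClassField F ι 1 →ₐ[F] ringClassField F ι 1) d.y = P (qσ σ) := fun σ ↦ by
    have h := (hqσ σ).2
    rw [MulEquiv.apply_symm_apply] at h
    rw [hy]; exact h
  ------------------------------------------------------------------ the principal genus = stabiliser of `√p` (index two)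
  have hrK := sq_eq_algebraMap_natCast' (ι := ι) hr
  have hd : ¬ IsSquare (p : F) := not_isSquare_natCast_of_discr_negTwoPrimes hF hq hp hdF
  have hΔ : hF.negDiscr.D = -((q : ℤ) * p) := by rw [hF.negDiscr_D, hdF]
  have hΔ4 : hF.negDiscr.D % 4 = 1 := by
    rw [hΔ]
    have hq' : (q : ℤ) % 4 = 3 := by exact_mod_cast hq4
    have hp' : (p : ℤ) % 4 = 1 := by exact_mod_cast hp4
    have : ((q : ℤ) * p) % 4 = 3 := by rw [Int.mul_emod, hq', hp']; norm_num
    omega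
  have hidx : (powMonoidHom 2 : ClassGroup (OrderCl.QO hF.negDiscr) →* ClassGroup (OrderCl.QO hF.negDiscr)).range.index = 2 :=
    index_range_sq_classGroup_QO_eq_two_negTwoPrimes hF.negDiscr hq hp hq2 hp2 hqp hΔ hΔ4
  haveI : Finite (ClassGroup (OrderCl.QO hF.negDiscr)) := Finite.of_equiv _ Θ.toEquiv.symm
  have hχ : ∀ σ : ringClassField F ι 1 ≃ₐ[F] ringClassField F ι 1,
      σ r = r ↔ Θ.symm σ ∈ (powMonoidHom 2 : _ →* ClassGroup (OrderCl.QO hF.negDiscr)).range :=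
    algEquiv_apply_sqrt_eq_iff_symm_mem_range_sq Θ hidx hrK hd
  -- `σ` in the principal genus ⟺ `[𝔞_{q(σ)}] ∈ Cl² · γ₀`, `γ₀ = [𝔞_{q₁}]`
  set γ₀ : ClassGroup (OrderCl.QO hF.negDiscr) := heegnerFormClass hF (q₁ : ℤ × ℤ × ℤ) with hγ₀
  have hcoset : ∀ σ : ringClassField F ι 1 ≃ₐ[F] ringClassField F ι 1,
      σ r = r ↔ ∃ δ, heegnerFormClass hF (qσ σ : ℤ × ℤ × ℤ) = δ ^ 2 * γ₀ := fun σ ↦ by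
    rw [hχ σ, (hqσ σ).1, hγ₀]
    constructor
    · rintro ⟨δ, hδ⟩
      exact ⟨δ, by rw [← hδ, powMonoidHom_apply]⟩
    · rintro ⟨δ, hδ⟩
      exact ⟨δ, by rw [powMonoidHom_apply]; exact (mul_right_cancel hδ).symm⟩
  ------------------------------------------------------------------ the complex point of `Φ` is the sum over the coset `Cl²γ₀`
  have hinjq : ∀ σ σ' : ringClassField F ι 1 ≃ₐ[F] ringClassField F ι 1, qσ σ = qσ σ' → σ = σ' := by
    intro σ σ' h
    have h1 := (hqσ σ).1
    rw [h, (hqσ σ').1] at h1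
    exact Θ.symm.injective (mul_right_cancel h1).symm
  have hsum : Affine.Point.map (ringClassField F ι 1).subtype.toRatAlgHom
      (∑ σ : ringClassField F ι 1 ≃ₐ[F] ringClassField F ι 1,
        (if σ r = r then (1 : ℤ) else 0) • Affine.Point.map (σ : ringClassField F ι 1 →ₐ[F] ringClassField F ι 1) d.y) =
      ∑ Q ∈ H.reps.filter (fun Q ↦ ∃ δ, heegnerFormClass hF Q = δ ^ 2 * γ₀), D₀.φ (heegnerTau Q) := by
    rw [map_sum]
    have h1 : ∀ σ : ringClassField F ι 1 ≃ₐ[F] ringClassField F ι 1,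
        Affine.Point.map (ringClassField F ι 1).subtype.toRatAlgHom
          ((if σ r = r then (1 : ℤ) else 0) • Affine.Point.map (σ : ringClassField F ι 1 →ₐ[F] ringClassField F ι 1) d.y) =
        if σ r = r then D₀.φ (heegnerTau (qσ σ : ℤ × ℤ × ℤ)) else 0 := fun σ ↦ by
      rw [map_zsmul, hqσ_map, hPφ]
      by_cases h : σ r = r
      · rw [if_pos h, if_pos h, one_zsmul]
      · rw [if_neg h, if_neg h, zero_zsmul]
    simp_rw [h1]
    rw [← Finset.sum_filter]
    refine Finset.sum_nbij (fun σ ↦ (qσ σ : ℤ × ℤ × ℤ)) (fun σ hσ ↦ ?_) (fun σ hσ σ' hσ' h ↦ ?_) (fun Q hQ ↦ ?_)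
      (fun _ _ ↦ rfl)
    · rw [Finset.mem_filter] at hσ ⊢
      exact ⟨(qσ σ).2, (hcoset σ).mp hσ.2⟩
    · exact hinjq σ σ' (Subtype.ext h)
    · obtain ⟨hQ, δ, hδ⟩ := Finset.mem_filter.mp (Finset.mem_coe.mp hQ)
      refine ⟨Θ (δ ^ 2), Finset.mem_coe.mpr (Finset.mem_filter.mpr ⟨Finset.mem_univ _, ?_⟩), ?_⟩
      · refine (hcoset _).mpr ⟨δ, ?_⟩
        rw [(hqσ _).1, MulEquiv.symm_apply_apply, hγ₀]
      · have hcl : heegnerFormClass hF (qσ (Θ (δ ^ 2)) : ℤ × ℤ × ℤ) = heegnerFormClass hF Q := by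
          rw [(hqσ _).1, MulEquiv.symm_apply_apply, hδ, hγ₀]
        exact heegnerFormClass_injOn_reps hF H (qσ _).2 hQ hcl
  ------------------------------------------------------------------ Gross's summed reflection law on `Cl²γ₀`; the count `#Cl²`
  have hW : IsFrickeEigen (cm7.conductorNorm ℤ) D₀.f (((-1 : ℤ)) : ℂ) := by
    push_cast
    exact isFrickeEigen_neg_one_of_rootNumber_eq_one cm7 D₀.isNewformOf hw
  have hν : ∃ μ, heegnerFormClass hF ((cm7.conductorNorm ℤ : ℤ), H.β,
      (H.β ^ 2 - NumberField.discr F) / (4 * cm7.conductorNorm ℤ)) = μ ^ 2 := by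
    have h7 : cm7.conductorNorm ℤ = 7 ^ 2 := by rw [conductorNorm_cm7]; norm_num
    haveI : NeZero (7 : ℕ) := ⟨by norm_num⟩
    refine ⟨_, ((heegnerFormClass_levelForm_eq_datum hF hND H q₁.2).symm.trans
      (heegnerFormClass_levelForm_eq_sq hF h7 hND (H.mem_heegnerForms _ q₁.2).1))⟩
  have hlaw := conjPoint_sum_φ_heegnerTau_sqCoset hF hH D₀ H hW (Or.inr rfl) γ₀ hν
  have hcard : (H.reps.filter (fun Q ↦ ∃ δ, heegnerFormClass hF Q = δ ^ 2 * γ₀)).card =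
      Nat.card (powMonoidHom 2 : ClassGroup (OrderCl.QO hF.negDiscr) →* ClassGroup (OrderCl.QO hF.negDiscr)).range :=
    card_filter_sqCoset_eq_natCard_range hF hH D₀ H ι γ₀
  obtain ⟨h0', hh⟩ := h0
  have hh' : D₀.cuspZeroPoint = Affine.Point.some 2 (-1) (nonsingular_cm7_baseChange_two_neg_one ℂ) := hh
  ------------------------------------------------------------------ conclusion in `E(ℂ)`
  have hTmap : Affine.Point.map (ringClassField F ι 1).subtype.toRatAlgHom
      (Affine.Point.some 2 (-1) (nonsingular_cm7_baseChange_two_neg_one (ringClassField F ι 1))) = D₀.cuspZeroPoint := by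
    rw [hh', Affine.Point.map_some]
    congr 1
  apply Affine.Point.map_injective (f := (ringClassField F ι 1).subtype.toRatAlgHom)
  rw [map_add, map_subtype_map_conj τ hτ, hsum, hlaw, map_nsmul, hTmap, hcard, neg_one_zsmul, neg_one_zsmul]
  abel

end HalfTrace

end Summit.BirchSwinnertonDyer.BirchSwinnertonDyer.Theorems.GoldfeldGoodTwists

end
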